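import Summits.QuantumFields.BalabanUV.T4Continuum.Spine.NE7.QLaTorusDictionary
import Literature.MathematicalPhysics.QuantumFieldTheory.Balaban1983to89.B7Prop1Local
import Literature.MathematicalPhysics.QuantumFieldTheory.Balaban1983to89.B8Ineq130

/-!
# Spine/NE7/QLaTorusB7Averaging — a SECOND inhabitant of `Setup.Averaging`: Bałaban's block averaging
# [Balaban1985Averaging] (15) = (42) (CORNER blocks, tree contours `Γ_{c,x}`), `G = U(N)`, realised ON THE TORUS through the
# periodic lift to the B7 fold's `ℤ^d`, with gauge covariance (11) and locality (p. 24) PROVED — the «dictionary» half (b),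
# obligations (O1)–(O3), of NODE S's bridge (census R39∕R45 fork (b-i))

Cell `pub-balaban-gaps` (YM blitz Y1, track G2, seat `ne7`, generation 6); text of record
`run/shared/lean/pub/pub-balaban-gaps/ne/NE7.md` v6 §4septies, census rows R39 (half (b)) ∕ R45 (fork (b-i)); scoping note
`pub-balaban-gaps-ne7/g5/HALF-B-SCOPE.md`.  Eighteenth `Spine/NE7/` file; companion of `QLaTorusDictionary` (the lifts).

WHY.  NODE S (= (QL-a)∣_{U=1}) consumes `HolDevBound av dom Cb θ` ⇐ `FramedBondLip av dom Cb θ` (files 8∕12) for a torus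
averaging `av : ∀ j, Setup.Averaging P j G`; the per-entry input [Balaban1985Averaging] Prop. 5 (156) is KERNEL-PROVED for the
B7 fold's CONCRETE `k`-fold averaging on `ℤ^d` (b07's `B7Prop5Flat`, files 11∕13∕14∕16), whose one-step average is (42) =
(15): `V̄_c = exp[Σ_{x∈B(c₋)} L^{−d} log V(Γ_{c,x})V(c)⁻¹]·V(c)` with CORNER blocks `B(y) = y + [0,L)^d` and the tree contours
`Γ_{c,x}` (14) (`B7Prop1Explicit.bavg`).  The tree had exactly ONE family of `Setup.Averaging` instances (the axial decimation
average of `AveragingRT`, and the abelian∕centred models of files 6∕9); THIS file builds the instance «B7 (15), corner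
blocks, periodic lift» (fork (b-i) of census R45 — NOT the averaging of record (0.4) of [Balaban1987RG1], which is pv26's
`BlockAveraging.blockAvg`; the T⁴ chain `FiniteEpsData.av` is PARAMETRIC in the averaging), so that NODE S's input chain can
be closed on Bałaban's own (15) by transporting the `ℤ^d` theorems.

WHAT IS HERE.  §1 the step on `ℤ^d` (unit lattice `Ω^{(1)} ≅ ℤ^d` after rescaling, as in `B7Prop2Explicit.avgIter`):
`cstep W (z, κ) = τ_W(z) · ḡb_W(⟨Lz, Lz+Le_κ⟩) · τ_W(z+e_κ)⁻¹`, where `ḡb` is (42) GUARDED by the hypothesis of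
`B7Prop2Explicit.bavg_mem_unitaryUnits` (all `V(Γ_{c,x})V(c)⁻¹` within `1/4` of `1`, (22)–(23) p. 21: then `V̄_c ∈ U(N)`)
with the straight transport `V(Γ_c) = V(c)` as the (covariant, unitary) junk branch — `Setup.Averaging.avg` is a TOTAL map
into `G`-valued fields, Bałaban's average is `G`-valued on a small-field domain only (`B7Prop2SpecialUnitary` §5: it FAILS
off it) — and `τ_W(z) = W(Γ_{cen z, Lz})` is the in-block transport from the CENTRE of the block to its CORNER along the fixed
tree word `w0` (the (c1) bridge of the scoping note: B7's (42) is covariant with the gauge factor at the corner `c₋ = Lz`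
((45) p. 24), Setup's axiom `Averaging.covariant` evaluates it at the centre `emb`, DIVERGENCE F3).  PROVED: `U(N)`-valuedness
(`cstep_mem`), covariance under unitary gauge functions `cstep (W^u)(z,κ) = u(cen z)·cstep W(z,κ)·u(cen(z+e_κ))⁻¹`
(`cstep_gaugeAct`, from b07's `bavg_gaugeAct` (45) inside the guard and `hol_gaugeAct` (8); the guard is gauge invariant
because conjugation by a unitary is an isometry), locality on the box `B(c₋) ∪ B(c₊)` (`cstep_congr`, from
`B7Prop1Local.bavg_congr` ∕ `Wcx_congr` ∕ `hol_treeWord_congr`), descent to the tori (`cstep_periodic`) and `cstep 1 = 1`.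
§2 THE INSTANCE `avgB7 P N j : Averaging P j (Matrix.unitaryGroup (Fin N) ℂ)`: `avg U c = cstep Ũ (tlift c₋, dir c)`; the two
axioms of `Setup.Averaging` — covariance (11) with Setup's `emb` and locality with Setup's `blockOf` — are DISCHARGED from §1
and the dictionary (`tcls_cen`, `blockOf_tcls`); `liftCfg_avgB7`: the lift intertwines `avgB7` with `cstep` (so iterates
are computed on `ℤ^d`); `avgB7_one`: the trivial configuration is fixed (`AvgFlat`).

HONEST FRAMING.  A DEFINITION with its two structural axioms proved ([folklore] bookkeeping over b07's kernel theorems for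
(42)); the guard makes the map total — on the small-field domain of the sequel it IS (42) conjugated to Setup's centred
convention, off it it is junk; `G = U(N)` (the `SU(N)` variant needs `B7Prop2SpecialUnitary.bavg_mem_specialUnitaryUnits`'
radius `Nt < π` and is NOT done); first-order agreement (14)∕analyticity are not part of `Setup.Averaging` (DIVERGENCE F6).
Nothing of the (1.100) insert, of (QL-a) or of NE7 is asserted: (QL-a) NOT IN PRINT; NE7 NOT proved; spine 0∕9; fixed finite
T⁴ — NOT ℝ⁴, NOT infinite volume, NOT a mass gap, NOT Clay.
-/

noncomputable section

open scoped BigOperators Matrix.Norms.L2Operator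

namespace Summit.QuantumFields.BalabanUV.T4Continuum.Spine.NE7.TorusB7

open Literature.MathematicalPhysics.QuantumFieldTheory.Balaban1983to89
open Literature.MathematicalPhysics.QuantumFieldTheory.Balaban1983to89.B7Prop1Explicit hiding Site
open Literature.MathematicalPhysics.QuantumFieldTheory.Balaban1983to89.B7Prop1Local (InBox AgreeOn bondHi bavg_congr
  Wcx_congr hol_treeWord_congr hol_seg_congr add_e_apply add_zsmul_e_apply)
open Literature.MathematicalPhysics.QuantumFieldTheory.Balaban1983to89.B7Prop2Explicit (unitaryUnits mem_unitaryUnits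
  bavg_mem_unitaryUnits unitaryUnits_le_U1 hol_mem_of)
open Literature.MathematicalPhysics.QuantumFieldTheory.Balaban1983to89.B8Ineq130 (hol_one bavg_one Wcx_one)
open Literature.MathematicalPhysics.QuantumFieldTheory.Balaban1983to89.T4TermwiseTorus (tcls tcls_apply tcls_add tlift
  tcls_tlift IsPeriodic hol_shift Wcx_shift bavg_shift)

variable {P : Params} {N : ℕ}

/-! ## §1 The guarded, centre-covariant B7 averaging step on `ℤ^d` (read on the unit lattice) -/

variable (P N)

/-- THE GUARD: all `V(Γ_{c,x})V(c)⁻¹`, `x ∈ B(c₋)`, of the `L`-bond `c = ⟨q, q + Le_κ⟩` lie within `1/4` of `1` (the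
hypothesis of b07's `B7Prop2Explicit.bavg_mem_unitaryUnits` = closure of `U(N)` under (42) by (22)–(23) p. 21 of [Balaban1985Averaging]; a cell-typed PREDICATE, not a printed statement). [folklore] -/
def Guard (W : (Fin P.d → ℤ) → Fin P.d → (Mat N)ˣ) (q : Fin P.d → ℤ) (κ : Fin P.d) : Prop :=
  ∀ r : Fin P.d → Fin P.L, ‖((Wcx P.L W q κ (boxVec P.L r) : (Mat N)ˣ) : Mat N) - 1‖ ≤ 1 / 4

open Classical in
/-- THE GUARDED ONE-STEP AVERAGE on the `L`-bond `⟨q, q + Le_κ⟩`: Bałaban's (42) `V̄_c` when the guard holds, the straight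
transport `V(Γ_c) = V(c)` otherwise (junk branch; both branches are `U(N)`-valued and gauge covariant). [cite: Balaban1985Averaging, (42) p.23] -/
def gb (W : (Fin P.d → ℤ) → Fin P.d → (Mat N)ˣ) (q : Fin P.d → ℤ) (κ : Fin P.d) : (Mat N)ˣ :=
  if Guard P N W q κ then bavg P.L W q κ else hol W q (seg κ P.L)

/-- The in-block transport (9) from the CENTRE of block `z` to its CORNER `L·z` along `w0` (the (c1) bridge centre ↔ corner, DIVERGENCE F3). [cite: Balaban1985Averaging, (9) p.18] -/
def frameTr (W : (Fin P.d → ℤ) → Fin P.d → (Mat N)ˣ) (z : Fin P.d → ℤ) : (Mat N)ˣ := hol W (cen P z) (w0 P)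

/-- THE CENTRE-COVARIANT STEP, read on the unit lattice `Ω^{(1)} ≅ ℤ^d`: the guarded average of the `L`-bond
`⟨Lz, Lz + Le_κ⟩` conjugated by the centre-to-corner transports of the blocks `z`, `z + e_κ` ((42) in Setup's centred convention). [cite: Balaban1985Averaging, (42)–(43) pp.23–24] -/
def cstep (W : (Fin P.d → ℤ) → Fin P.d → (Mat N)ˣ) : (Fin P.d → ℤ) → Fin P.d → (Mat N)ˣ :=
  fun z κ => frameTr P N W z * gb P N W ((P.L : ℤ) • z) κ * (frameTr P N W (z + e κ))⁻¹

variable {P N}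

/-- The centre-to-corner transport of a `U(N)`-valued configuration is in `U(N)`. [folklore] -/
theorem frameTr_mem {W : (Fin P.d → ℤ) → Fin P.d → (Mat N)ˣ} (hW : ∀ x κ, W x κ ∈ unitaryUnits (Mat N))
    (z : Fin P.d → ℤ) : frameTr P N W z ∈ unitaryUnits (Mat N) := hol_mem_of hW _ _

section Values

/-- Both branches of the guarded average are `U(N)`-valued (b07's `bavg_mem_unitaryUnits` inside the guard). [cite: Balaban1985Averaging, (22)–(23) p.21] -/
theorem gb_mem {W : (Fin P.d → ℤ) → Fin P.d → (Mat N)ˣ} (hW : ∀ x κ, W x κ ∈ unitaryUnits (Mat N))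
    (q : Fin P.d → ℤ) (κ : Fin P.d) : gb P N W q κ ∈ unitaryUnits (Mat N) := by
  classical
  letI : CStarAlgebra (Mat N) := {}
  unfold gb
  split_ifs with h
  · exact bavg_mem_unitaryUnits hW P.L q κ h
  · exact hol_mem_of hW _ _

/-- **The step is `U(N)`-valued** — for EVERY `U(N)`-valued configuration (the guard's job). [folklore] -/
theorem cstep_mem {W : (Fin P.d → ℤ) → Fin P.d → (Mat N)ˣ} (hW : ∀ x κ, W x κ ∈ unitaryUnits (Mat N))
    (z : Fin P.d → ℤ) (κ : Fin P.d) : cstep P N W z κ ∈ unitaryUnits (Mat N) :=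
  (unitaryUnits (Mat N)).mul_mem ((unitaryUnits (Mat N)).mul_mem (frameTr_mem hW z) (gb_mem hW _ κ))
    ((unitaryUnits (Mat N)).inv_mem (frameTr_mem hW _))

end Values

/-! ### Gauge covariance of the step under unitary gauge functions -/

/-- (8) for the centre-to-corner transport: `τ_{V^u}(z) = u(cen z)·τ_V(z)·u(Lz)⁻¹`. [cite: Balaban1985Averaging, (8) p.18] -/
theorem frameTr_gaugeAct (u : (Fin P.d → ℤ) → (Mat N)ˣ) (W : (Fin P.d → ℤ) → Fin P.d → (Mat N)ˣ) (z : Fin P.d → ℤ) :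
    frameTr P N (gaugeAct u W) z = u (cen P z) * frameTr P N W z * (u ((P.L : ℤ) • z))⁻¹ := by
  rw [frameTr, hol_gaugeAct, cen_add_disp_w0]; rfl

section Covariance

variable [NeZero N]

/-- Conjugation by a unitary unit preserves `|· − 1|` (operator norm (19); the tree's `UnitaryModel.opDist1_conj_eq`). [cite: Balaban1985Averaging, (19) p.21] -/
theorem norm_conj_sub_one {u : (Mat N)ˣ} (hu : u ∈ unitaryUnits (Mat N)) (X : Mat N) :
    ‖(u : Mat N) * X * ((u⁻¹ : (Mat N)ˣ) : Mat N) - 1‖ = ‖X - 1‖ := by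
  letI : CStarAlgebra (Mat N) := {}
  have h1 := unitaryUnits_le_U1 hu
  exact UnitaryModel.opDist1_conj_eq (Units.mul_inv u) (Units.inv_mul u) h1.1 h1.2

/-- The guard is gauge invariant under unitary gauge functions ((11) for the loops `V(Γ_{c,x})V(c)⁻¹`: conjugation by `u(c₋)`). [cite: Balaban1985Averaging, (45) p.24] -/
theorem guard_gaugeAct {u : (Fin P.d → ℤ) → (Mat N)ˣ} (hu : ∀ x, u x ∈ unitaryUnits (Mat N))
    (W : (Fin P.d → ℤ) → Fin P.d → (Mat N)ˣ) (q : Fin P.d → ℤ) (κ : Fin P.d) :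
    Guard P N (gaugeAct u W) q κ ↔ Guard P N W q κ := by
  unfold Guard
  refine forall_congr' fun r => ?_
  rw [Wcx_gaugeAct, Units.val_mul, Units.val_mul, norm_conj_sub_one (hu q)]

/-- (45) = (11) for the guarded average: `ḡb(V^u)_c = u(c₋)·ḡb(V)_c·u(c₊)⁻¹` (b07's `bavg_gaugeAct` inside the guard, `hol_gaugeAct` outside). [cite: Balaban1985Averaging, (45) p.24] -/
theorem gb_gaugeAct {u : (Fin P.d → ℤ) → (Mat N)ˣ} (hu : ∀ x, u x ∈ unitaryUnits (Mat N))
    (W : (Fin P.d → ℤ) → Fin P.d → (Mat N)ˣ) (q : Fin P.d → ℤ) (κ : Fin P.d) :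
    gb P N (gaugeAct u W) q κ = u q * gb P N W q κ * (u (q + (P.L : ℤ) • e κ))⁻¹ := by
  classical
  letI : CStarAlgebra (Mat N) := {}
  unfold gb
  rw [if_congr (guard_gaugeAct hu W q κ) rfl rfl]
  split_ifs with h
  · exact bavg_gaugeAct P.L (fun x => unitaryUnits_le_U1 (hu x)) W q κ fun r => (h r).trans_lt (by norm_num)
  · rw [hol_gaugeAct, disp_seg]

/-- **GAUGE COVARIANCE (11) OF THE CENTRE-COVARIANT STEP**, for unitary gauge functions: `cstep (W^u)(z, κ) =
u(cen z) · cstep W (z, κ) · u(cen (z + e_κ))⁻¹`. [cite: Balaban1985Averaging, (11) p.19, (45) p.24] -/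
theorem cstep_gaugeAct {u : (Fin P.d → ℤ) → (Mat N)ˣ} (hu : ∀ x, u x ∈ unitaryUnits (Mat N))
    (W : (Fin P.d → ℤ) → Fin P.d → (Mat N)ˣ) (z : Fin P.d → ℤ) (κ : Fin P.d) :
    cstep P N (gaugeAct u W) z κ = u (cen P z) * cstep P N W z κ * (u (cen P (z + e κ)))⁻¹ := by
  simp only [cstep, frameTr_gaugeAct, gb_gaugeAct hu, smul_add, mul_inv_rev, inv_inv]
  simp only [mul_assoc, inv_mul_cancel_left]

end Covariance

/-! ### Locality of the step -/

section Locality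

/-- Locality of the guard: it reads only the bonds of `B(c₋) ∪ B(c₊)` (b07's `Wcx_congr`). [cite: Balaban1985Averaging, p.24 (after (43))] -/
theorem guard_congr {W W' : (Fin P.d → ℤ) → Fin P.d → (Mat N)ˣ} (q : Fin P.d → ℤ) (κ : Fin P.d)
    (h : AgreeOn q (bondHi P.L q κ) W W') : Guard P N W q κ ↔ Guard P N W' q κ := by
  have hL : 1 ≤ P.L := P.L_pos
  have hq : InBox q (bondHi P.L q κ) q := fun i => by
    simp only [bondHi]; split_ifs <;> omega
  have hqL : InBox q (bondHi P.L q κ) (q + (P.L : ℤ) • e κ) := fun i => by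
    simp only [bondHi, add_zsmul_e_apply]; split_ifs <;> omega
  have hW : ∀ r : Fin P.d → Fin P.L, Wcx P.L W q κ (boxVec P.L r) = Wcx P.L W' q κ (boxVec P.L r) := by
    intro r
    have hr : ∀ i, 0 ≤ boxVec P.L r i ∧ boxVec P.L r i + 1 ≤ P.L := fun i =>
      ⟨by simp [boxVec], by have := (r i).isLt; simp only [boxVec]; omega⟩
    refine Wcx_congr P.L h q κ _ hq (fun i => ?_) (fun i => ?_) hqL
    · have := hr i; simp only [bondHi, Pi.add_apply]; split_ifs <;> omega
    · have := hr i
      simp only [bondHi, Pi.add_apply, Pi.smul_apply, smul_eq_mul, e_apply, mul_ite, mul_one, mul_zero]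
      split_ifs <;> omega
  unfold Guard
  simp only [hW]

/-- Locality of the guarded average (b07's `bavg_congr`, `hol_seg_congr`). [cite: Balaban1985Averaging, p.24 (after (43))] -/
theorem gb_congr {W W' : (Fin P.d → ℤ) → Fin P.d → (Mat N)ˣ} (q : Fin P.d → ℤ) (κ : Fin P.d)
    (h : AgreeOn q (bondHi P.L q κ) W W') : gb P N W q κ = gb P N W' q κ := by
  classical
  have hL : 1 ≤ P.L := P.L_pos
  have hq : InBox q (bondHi P.L q κ) q := fun i => by
    simp only [bondHi]; split_ifs <;> omega
  have hqL : InBox q (bondHi P.L q κ) (q + (P.L : ℤ) • e κ) := fun i => by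
    simp only [bondHi, add_zsmul_e_apply]; split_ifs <;> omega
  unfold gb
  rw [if_congr (guard_congr q κ h) (bavg_congr P.L hL q κ h) (hol_seg_congr h κ P.L q hq hqL)]

/-- The box `[Lz, Lz + (L−1)𝟙 + Le_κ] = B(c₋) ∪ B(c₊)` contains the centre-to-corner paths of both blocks: locality of the transports. [cite: Balaban1985Averaging, p.24 (after (43))] -/
theorem frameTr_congr {W W' : (Fin P.d → ℤ) → Fin P.d → (Mat N)ˣ} (z : Fin P.d → ℤ) (κ : Fin P.d)
    (h : AgreeOn ((P.L : ℤ) • z) (bondHi P.L ((P.L : ℤ) • z) κ) W W') :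
    frameTr P N W z = frameTr P N W' z ∧ frameTr P N W (z + e κ) = frameTr P N W' (z + e κ) := by
  have hh := hb_le P
  have hL : (1 : ℤ) ≤ P.L := by exact_mod_cast P.L_pos
  constructor
  · refine hol_treeWord_congr h _ _ (fun i => ?_) (fun i => ?_)
    · simp only [cen, bondHi, Pi.smul_apply, smul_eq_mul]; split_ifs <;> constructor <;> nlinarith
    · rw [show cen P z + (fun _ => -(hb P : ℤ)) = cen P z + disp (w0 P) by rw [w0, disp_treeWord], cen_add_disp_w0]
      simp only [bondHi, Pi.smul_apply, smul_eq_mul]; split_ifs <;> constructor <;> nlinarith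
  · refine hol_treeWord_congr h _ _ (fun i => ?_) (fun i => ?_)
    · simp only [cen, bondHi, Pi.smul_apply, smul_eq_mul, Pi.add_apply, e_apply]
      split_ifs <;> constructor <;> nlinarith
    · rw [show cen P (z + e κ) + (fun _ => -(hb P : ℤ)) = cen P (z + e κ) + disp (w0 P) by rw [w0, disp_treeWord],
        cen_add_disp_w0]
      simp only [bondHi, Pi.smul_apply, smul_eq_mul, Pi.add_apply, e_apply]
      split_ifs <;> constructor <;> nlinarith

/-- **LOCALITY OF THE STEP**: `cstep W (z, κ)` depends only on the bond variables of `W` in the box `B(c₋) ∪ B(c₊)` of the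
`L`-bond `c = ⟨Lz, Lz + Le_κ⟩` (p. 24: «this definition is local …»). [cite: Balaban1985Averaging, p.24 (after (43))] -/
theorem cstep_congr {W W' : (Fin P.d → ℤ) → Fin P.d → (Mat N)ˣ} (z : Fin P.d → ℤ) (κ : Fin P.d)
    (h : AgreeOn ((P.L : ℤ) • z) (bondHi P.L ((P.L : ℤ) • z) κ) W W') : cstep P N W z κ = cstep P N W' z κ := by
  obtain ⟨h1, h2⟩ := frameTr_congr (N := N) z κ h
  simp only [cstep, h1, h2, gb_congr _ κ h]

end Locality

/-! ### Periodicity: the step descends to the tori -/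

section Periodic

variable {T : ℕ} {W : (Fin P.d → ℤ) → Fin P.d → (Mat N)ˣ}

/-- The centre-to-corner transports of a `T·L`-periodic configuration are `T`-periodic on the coarse lattice. [folklore] -/
theorem frameTr_periodic (hW : IsPeriodic (T * P.L) W) : IsPeriodic T (frameTr P N W) := fun z m => by
  have h : hol W (cen P z + ((T * P.L : ℕ) : ℤ) • m) (w0 P) = hol W (cen P z) (w0 P) := (hW.hol (w0 P)) (cen P z) m
  simp only [frameTr, cen_add]
  rw [← h, smul_smul, Nat.cast_mul, mul_comm (T : ℤ)]

/-- The guard of a periodic configuration is periodic. [folklore] -/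
theorem guard_periodic (hW : IsPeriodic T W) (q m : Fin P.d → ℤ) (κ : Fin P.d) :
    Guard P N W (q + (T : ℤ) • m) κ ↔ Guard P N W q κ := by
  have hfun : (fun y ν => W (y + (T : ℤ) • m) ν) = W := funext fun y => funext fun ν => by rw [hW y m]
  unfold Guard
  refine forall_congr' fun r => ?_
  rw [← Wcx_shift P.L W ((T : ℤ) • m) q κ, hfun]

/-- The guarded average of a `T`-periodic configuration is `T`-periodic on the `L`-lattice (`T4TermwiseTorus.IsPeriodic.bavg`). [folklore] -/
theorem gb_periodic (hW : IsPeriodic T W) : IsPeriodic T (gb P N W) := fun q m => by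
  classical
  funext κ
  unfold gb
  rw [if_congr (guard_periodic hW q m κ) (congrFun (hW.bavg P.L q m) κ) ((hW.hol _) q m)]

/-- **THE STEP DESCENDS TO THE TORI**: for a `T·L`-periodic `W` (a configuration on the fine torus), `cstep W` is
`T`-periodic (a configuration on the coarse torus) — B7 p. 19 «Ω^{(j)} may be replaced by any other lattice», the torus of B12 (0.1). [cite: Balaban1987RG1, (0.1) p.251] -/
theorem cstep_periodic (hW : IsPeriodic (T * P.L) W) : IsPeriodic T (cstep P N W) := fun z m => by
  funext κ
  have h1 := frameTr_periodic (N := N) hW z m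
  have h2 : frameTr P N W (z + (T : ℤ) • m + e κ) = frameTr P N W (z + e κ) := by
    rw [add_right_comm]; exact frameTr_periodic (N := N) hW (z + e κ) m
  have h3 : gb P N W ((P.L : ℤ) • (z + (T : ℤ) • m)) κ = gb P N W ((P.L : ℤ) • z) κ := by
    have := gb_periodic (N := N) hW ((P.L : ℤ) • z) m
    rw [smul_add, smul_smul,
      show ((P.L : ℤ) * (T : ℤ)) • m = ((T * P.L : ℕ) : ℤ) • m by rw [Nat.cast_mul, mul_comm]]
    exact congrFun this κ
  simp only [cstep, h1, h2, h3]

end Periodic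

/-! ### The trivial configuration is fixed -/

/-- The guard holds at the trivial configuration (`V(Γ_{c,x})V(c)⁻¹ = 1`). [folklore] -/
theorem guard_one (q : Fin P.d → ℤ) (κ : Fin P.d) : Guard P N (1 : (Fin P.d → ℤ) → Fin P.d → (Mat N)ˣ) q κ := by
  intro r
  rw [Wcx_one]; simp

/-- The step fixes the trivial configuration: `cstep 1 = 1` (b07∕b08's `bavg_one`, `hol_one`). [folklore] -/
@[simp] theorem cstep_one : cstep P N (1 : (Fin P.d → ℤ) → Fin P.d → (Mat N)ˣ) = 1 := by
  funext z κ
  simp [cstep, frameTr, gb, guard_one, hol_one, bavg_one]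

/-! ## §2 The `Setup.Averaging` instance «B7 (15), corner blocks, periodic lift» for `G = U(N)` -/

section Instance

variable [NeZero N]

variable (P N) in
/-- **THE AVERAGING OF [Balaban1985Averaging] (15)/(42) AS A `Setup.Averaging` ON THE TORUS, `G = U(N)`**: lift the
level-`j` torus configuration to the periodic configuration on `ℤ^d`, apply the guarded centre-covariant step, read the
`L`-bond of the coarse torus bond `c` at the representative `tlift c₋`; covariance (11) and locality (p. 24) PROVED. [cite: Balaban1985Averaging, (15) p.19, (42)–(43) pp.23–24, (11) p.19] -/
def avgB7 (j : ℕ) : Averaging P j (Matrix.unitaryGroup (Fin N) ℂ) where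
  avg U c := ⟨(cstep P N (liftCfg U) (tlift c.src) c.dir : (Mat N)ˣ), cstep_mem (liftCfg_mem U) _ _⟩
  covariant hj u U := by
    funext c
    apply Subtype.ext
    simp only [liftCfg_gaugeAct, cstep_gaugeAct (liftTransf_mem u), Units.val_mul, val_liftTransf, val_inv_liftTransf,
      tcls_cen hj, tcls_add_e, tcls_tlift]
    rfl
  local_dep hj U U' c hUU' := by
    apply Subtype.ext
    simp only
    congr 1
    refine cstep_congr _ _ fun x μ hx _ => ?_
    -- a bond issuing from the box `B(c₋) ∪ B(c₊)` issues from the block of `c₋` or from the block of `c₊`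
    have hlo : ∀ i, (P.L : ℤ) * tlift c.src i ≤ x i := fun i => by simpa using (hx i).1
    have hhi : ∀ i, x i ≤ (P.L : ℤ) * tlift c.src i + ((P.L : ℤ) - 1) + (if i = c.dir then (P.L : ℤ) else 0) :=
      fun i => by simpa [bondHi] using (hx i).2
    have key : blockOf (tcls (per P j) x : Site P j) = c.src ∨ blockOf (tcls (per P j) x : Site P j) = c.tgt := by
      by_cases hκ : x c.dir ≤ (P.L : ℤ) * tlift c.src c.dir + ((P.L : ℤ) - 1)
      · left
        rw [blockOf_tcls hj (tlift c.src) x fun i => ⟨hlo i, ?_⟩, tcls_tlift]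
        rcases eq_or_ne i c.dir with rfl | hi
        · exact hκ
        · have := hhi i; rw [if_neg hi, add_zero] at this; exact this
      · right
        replace hκ := not_le.mp hκ
        rw [PBond.tgt, ← tcls_tlift (T := per P (j + 1)) c.src, ← tcls_add_e,
          blockOf_tcls hj (tlift c.src + e c.dir) x fun i => ?_]
        rcases eq_or_ne i c.dir with rfl | hi
        · have := hhi c.dir
          rw [if_pos rfl] at this
          simp only [Pi.add_apply, e_apply, ↓reduceIte]
          constructor <;> linarith
        · have := hhi i
          rw [if_neg hi, add_zero] at this
          simp only [Pi.add_apply, e_apply, if_neg hi, add_zero]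
          exact ⟨hlo i, this⟩
    have := hUU' ⟨tcls (per P j) x, μ⟩ key
    simp only [liftCfg, this]

/-- Unfolding: the bond variable `(avgB7 U)(c)` IS the centre-covariant step of the lift at the representative of `c₋`. [folklore] -/
theorem val_avgB7 (j : ℕ) (U : GaugeField P j (Matrix.unitaryGroup (Fin N) ℂ)) (c : PBond P (j + 1)) :
    (((avgB7 P N j).avg U c : Matrix.unitaryGroup (Fin N) ℂ) : Mat N) = (cstep P N (liftCfg U) (tlift c.src) c.dir : Mat N) :=
  rfl

/-- Unfolding at the level of units: `(avgB7 U)(c)`, as a unit of `M_N(ℂ)`, is `cstep Ũ (tlift c₋, dir c)`. [folklore] -/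
theorem toUnits_avgB7 (j : ℕ) (U : GaugeField P j (Matrix.unitaryGroup (Fin N) ℂ)) (c : PBond P (j + 1)) :
    Unitary.toUnits ((avgB7 P N j).avg U c) = cstep P N (liftCfg U) (tlift c.src) c.dir :=
  Units.ext rfl

/-- **THE LIFT INTERTWINES THE TORUS AVERAGING WITH THE `ℤ^d` STEP** (in the standing range `j + 1 ≤ m + K`, where
`T_j = T_{j+1}·L`): `(avgB7 U)~ = cstep Ũ` as configurations on `ℤ^d`. [folklore] -/
theorem liftCfg_avgB7 {j : ℕ} (hj : j + 1 ≤ P.m + P.K) (U : GaugeField P j (Matrix.unitaryGroup (Fin N) ℂ)) :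
    liftCfg ((avgB7 P N j).avg U) = cstep P N (liftCfg U) := by
  have hper : IsPeriodic (per P (j + 1)) (cstep P N (liftCfg U)) := by
    refine cstep_periodic ?_
    rw [← per_succ hj]
    exact liftCfg_periodic U
  funext x κ
  rw [liftCfg, toUnits_avgB7]
  exact congrFun (hper.apply_tlift x) κ

/-- **THE TRIVIAL CONFIGURATION IS FIXED**: `avgB7 1 = 1` at every level (clause `AvgFlat` of NODE S's bookkeeping, file 5). [folklore] -/
theorem avgB7_one (j : ℕ) : (avgB7 P N j).avg (1 : GaugeField P j (Matrix.unitaryGroup (Fin N) ℂ)) = 1 := by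
  funext c
  apply Subtype.ext
  rw [val_avgB7, liftCfg_one, cstep_one]
  rfl

end Instance

end Summit.QuantumFields.BalabanUV.T4Continuum.Spine.NE7.TorusB7

end
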